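import Mathlib.Analysis.SpecialFunctions.Pow.Deriv
import Mathlib.Analysis.SpecialFunctions.Pow.Real
import Mathlib.Tactic

/-!
# `MultiplicationThree` (stmt-KontsevichZagierPeriods-3598) — negative knowledge, part 8: the attack on the
cheapest line failed — the bolza identities are EXACT (cdisprove gen 2, cycle 2)

Idea card `bolza-involution-real-quotient`: (i) the involution `ι_u(v) = (1−u−v)/(1−v)` swaps the box
densities `ψ = v^{−2/3}(1−v)^{−2/3}(1−u−v)^{−1/3}`, `ψ̄ = v^{−1/3}(1−v)^{−1/3}(1−u−v)^{−2/3}`; (ii) the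
chart `a = −(z−1)²/z`, `z³ = v(1−v)/(1−u−v)`, has `|∂a/∂v|/√Q(a,u) = (ψ+ψ̄)/3`, `Q(a,u) = a²(3−a)²−4ua`;
(iii) torsion on the level-3 pencil `w² = Q`. The card's evidence for (i)–(ii) was numerical; here they
are PROVED as exact real-power identities, with the sign of the chart's derivative on the two cells
(strict monotonicity ⇒ injectivity), and the level-3 input of (iii). Mathlib-only.
(Cruxes/MultiplicationThree/Disproof.lean §8.)
-/

noncomputable section

open Real

namespace Summit.KontsevichZagierPeriods.TerasomaMultiplication.MultiplicationThreeNegative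

/-- **(β) exact — algebra of the involution.** `ι_u(v) = (1−u−v)/(1−v)` satisfies
`1 − ι = u/(1−v)`, `1 − u − ι = uv/(1−v)` and `ι'(v) = −u/(1−v)²`. [folklore] -/
theorem bolza_involution_algebra (u v : ℝ) (hv : v ≠ 1) :
    1 - (1 - u - v) / (1 - v) = u / (1 - v) ∧
      1 - u - (1 - u - v) / (1 - v) = u * v / (1 - v) ∧
      HasDerivAt (fun t : ℝ => (1 - u - t) / (1 - t)) (-u / (1 - v) ^ 2) v := by
  have hv' : (1 - v) ≠ 0 := sub_ne_zero.mpr (Ne.symm hv)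
  refine ⟨?_, ?_, ?_⟩
  · field_simp; ring
  · field_simp; ring
  · have hnum : HasDerivAt (fun t : ℝ => 1 - u - t) (-1) v := by
      simpa using (hasDerivAt_id v).const_sub (1 - u)
    have hden : HasDerivAt (fun t : ℝ => 1 - t) (-1) v := by
      simpa using (hasDerivAt_id v).const_sub 1
    refine (hnum.div hden hv').congr_deriv ?_
    ring

/-- **(β) exact — the involution swaps the two box densities**: `ψ(ι v)·|ι'(v)| = ψ̄(v)` on
`0 < u`, `0 < v < 1 − u`, where `ψ = v^{−2/3}(1−v)^{−2/3}(1−u−v)^{−1/3}` and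
`ψ̄ = v^{−1/3}(1−v)^{−1/3}(1−u−v)^{−2/3}` (card bolza-involution-real-quotient, step (i): one rule-(2)
move `[Σ_box, u^{s−1}ψ] ~ [Σ_box, u^{s−1}ψ̄]`). Proof: cube both sides. [folklore] -/
theorem bolza_involution_density {u v : ℝ} (hu : 0 < u) (hv : 0 < v) (huv : v < 1 - u) :
    ((1 - u - v) / (1 - v)) ^ (-(2:ℝ)/3) * (u / (1 - v)) ^ (-(2:ℝ)/3) *
        (u * v / (1 - v)) ^ (-(1:ℝ)/3) * (u / (1 - v) ^ 2) =
      v ^ (-(1:ℝ)/3) * (1 - v) ^ (-(1:ℝ)/3) * (1 - u - v) ^ (-(2:ℝ)/3) := by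
  have h1v : 0 < 1 - v := by linarith
  have hN : 0 < 1 - u - v := by linarith
  apply (Odd.strictMono_pow (R := ℝ) (n := 3) (by decide)).injective
  simp only
  rw [mul_pow, mul_pow, mul_pow, mul_pow, mul_pow,
    ← rpow_mul_natCast (div_pos hN h1v).le, ← rpow_mul_natCast (div_pos hu h1v).le,
    ← rpow_mul_natCast (div_pos (mul_pos hu hv) h1v).le, ← rpow_mul_natCast hv.le,
    ← rpow_mul_natCast h1v.le, ← rpow_mul_natCast hN.le]
  norm_num
  simp only [Real.rpow_neg_one]
  field_simp

/-- **The simplex pencil in the cube-root coordinate**: with `a = −(z−1)²/z`,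
`Q(a,u) = a²(3−a)² − 4ua = (z−1)²((z³−1)² + 4uz³)/z⁴` (the card's "`w² = (z−1)²[(z³−1)² + 4uz³]/z⁴
= a²(3−a)² − 4ua`", an identity of rational functions). [folklore] -/
theorem bolza_Q_in_z (u z : ℝ) (hz : z ≠ 0) :
    (-(z - 1) ^ 2 / z) ^ 2 * (3 - -(z - 1) ^ 2 / z) ^ 2 - 4 * u * (-(z - 1) ^ 2 / z) =
      (z - 1) ^ 2 * ((z ^ 3 - 1) ^ 2 + 4 * u * z ^ 3) / z ^ 4 := by
  field_simp
  ring

/-- **(γ) exact — algebraic core of the card's key identity.** If `z³(1−u−v) = v(1−v)` (the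
cube-root chart) then, with `a_z = −(z−1)(z+1)/z² = da/dz` and
`z_v = ((1−v)² − u(1−2v))/(3z²(1−u−v)²) = ∂z/∂v` (implicit differentiation, `hasDerivAt_bolza_chart`),
`(a_z·z_v)² = Q(a,u)·((1+z)/(3z²(1−u−v)))²`; and `(1+z)/(z²(1−u−v)) = ψ + ψ̄`
(`bolza_psi_identities`). The card verified this numerically at 25 points (kit j005071); it is a
polynomial identity: `((1−v)² − u(1−2v))² = ((1−v)² − u)² + 4uv(1−v)(1−u−v)`. [folklore] -/
theorem bolza_key_identity_exact (u v z : ℝ) (huv : 1 - u - v ≠ 0) (hz : z ≠ 0)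
    (hz3 : z ^ 3 * (1 - u - v) = v * (1 - v)) :
    ((-(z - 1) * (z + 1) / z ^ 2) *
        (((1 - v) ^ 2 - u * (1 - 2 * v)) / (3 * z ^ 2 * (1 - u - v) ^ 2))) ^ 2 =
      ((-(z - 1) ^ 2 / z) ^ 2 * (3 - -(z - 1) ^ 2 / z) ^ 2 - 4 * u * (-(z - 1) ^ 2 / z)) *
        ((1 + z) / (3 * z ^ 2 * (1 - u - v))) ^ 2 := by
  rw [bolza_Q_in_z u z hz]
  have key : ((1 - v) ^ 2 - u * (1 - 2 * v)) ^ 2 =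
      ((z ^ 3 - 1) ^ 2 + 4 * u * z ^ 3) * (1 - u - v) ^ 2 := by
    have h1 : (z ^ 3 - 1) * (1 - u - v) = v * (1 - v) - (1 - u - v) := by
      linear_combination hz3
    calc ((1 - v) ^ 2 - u * (1 - 2 * v)) ^ 2
        = (v * (1 - v) - (1 - u - v)) ^ 2 + 4 * u * (v * (1 - v)) * (1 - u - v) := by ring
      _ = ((z ^ 3 - 1) * (1 - u - v)) ^ 2 + 4 * u * (z ^ 3 * (1 - u - v)) * (1 - u - v) := by
          rw [h1, hz3]
      _ = ((z ^ 3 - 1) ^ 2 + 4 * u * z ^ 3) * (1 - u - v) ^ 2 := by ring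
  have hrepl : (z ^ 3 - 1) ^ 2 + 4 * u * z ^ 3 =
      ((1 - v) ^ 2 - u * (1 - 2 * v)) ^ 2 / (1 - u - v) ^ 2 := by
    rw [key]; field_simp
  rw [hrepl]
  field_simp
  ring

/-- **(δ) — the points at infinity of the simplex pencil are flexes.** On the cubic model
`η² = ξ³ + 9ξ² + 24uξ + 16u²` (`ξ = −4u/a`, `quartic_to_cubic`), the tangent `η = 3ξ + 4u` at
`(0, 4u)` meets the curve only at `ξ = 0` (triply): `(0, ±4u)` — the two points `a = ∞` — are flexes,
hence the rational 3-torsion points for the flex origin `ξ = ∞` (`a = 0`); translation by them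
permutes the three arcs of the unbounded real component (the card's `2/3 : 1 : 1/3`). [folklore] -/
theorem hesse_pencil_flex (u ξ : ℝ) :
    (3 * ξ + 4 * u) ^ 2 - (ξ ^ 3 + 9 * ξ ^ 2 + 24 * u * ξ + 16 * u ^ 2) = -ξ ^ 3 := by ring

/-- **(δ) — quartic-to-cubic.** `w² = a²(3−a)² − 4ua` iff `(4uw/a²)² = ξ³ + 9ξ² + 24uξ + 16u²` with
`ξ = −4u/a` (`a, u ≠ 0`): the simplex pencil `E_u` is the card's level-3 cubic. [folklore] -/
theorem quartic_to_cubic (u a w : ℝ) (ha : a ≠ 0) (hu : u ≠ 0) :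
    w ^ 2 = a ^ 2 * (3 - a) ^ 2 - 4 * u * a ↔
      (4 * u * w / a ^ 2) ^ 2 = (-4 * u / a) ^ 3 + 9 * (-4 * u / a) ^ 2 + 24 * u * (-4 * u / a) +
        16 * u ^ 2 := by
  constructor
  · intro h
    rw [div_pow, show (4 * u * w) ^ 2 = 16 * u ^ 2 * w ^ 2 by ring, h]
    field_simp
    ring
  · intro h
    field_simp at h
    linear_combination h / 16


/-- **(γ) — the cube-root chart is differentiable with the implicit derivative**:
`d/dv (v(1−v)/(1−u−v))^{1/3} = ((1−v)² − u(1−2v))/(3z²(1−u−v)²)`, `z` the chart. [folklore] -/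
theorem hasDerivAt_bolza_chart {u v : ℝ} (hu : 0 < u) (hv : 0 < v) (huv : v < 1 - u) :
    HasDerivAt (fun t : ℝ => (t * (1 - t) / (1 - u - t)) ^ ((1:ℝ)/3))
      (((1 - v) ^ 2 - u * (1 - 2 * v)) /
        (3 * ((v * (1 - v) / (1 - u - v)) ^ ((1:ℝ)/3)) ^ 2 * (1 - u - v) ^ 2)) v := by
  have hN : 0 < 1 - u - v := by linarith
  have h1v : 0 < 1 - v := by linarith
  have hg_pos : 0 < v * (1 - v) / (1 - u - v) := div_pos (mul_pos hv h1v) hN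
  have hg : HasDerivAt (fun t : ℝ => t * (1 - t) / (1 - u - t))
      (((1 * (1 - v) + v * -1) * (1 - u - v) - v * (1 - v) * -1) / (1 - u - v) ^ 2) v := by
    have h1 : HasDerivAt (fun t : ℝ => t * (1 - t)) (1 * (1 - v) + v * -1) v :=
      (hasDerivAt_id' v).mul ((hasDerivAt_id' v).const_sub 1)
    have h2 : HasDerivAt (fun t : ℝ => 1 - u - t) (-1) v := by
      simpa using (hasDerivAt_id v).const_sub (1 - u)
    exact h1.div h2 hN.ne'
  have hd := hg.rpow_const (p := (1:ℝ)/3) (Or.inl hg_pos.ne')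
  refine hd.congr_deriv ?_
  have hexp : (v * (1 - v) / (1 - u - v)) ^ ((1:ℝ)/3 - 1) =
      (((v * (1 - v) / (1 - u - v)) ^ ((1:ℝ)/3)) ^ 2)⁻¹ := by
    rw [show (1:ℝ)/3 - 1 = -((1:ℝ)/3 * 2) by norm_num, rpow_neg hg_pos.le, rpow_mul hg_pos.le,
      rpow_two]
  rw [hexp]
  have hz : ((v * (1 - v) / (1 - u - v)) ^ ((1:ℝ)/3)) ^ 2 ≠ 0 :=
    pow_ne_zero _ (rpow_pos_of_pos hg_pos _).ne'
  field_simp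
  ring

/-- **(γ) — the two box densities in the chart**: `ψ̄ = z·ψ` and `ψ·z²·(1−u−v) = 1`, so
`ψ + ψ̄ = (1+z)/(z²(1−u−v))`. Proof: cube both sides. [folklore] -/
theorem bolza_psi_identities {u v : ℝ} (hu : 0 < u) (hv : 0 < v) (huv : v < 1 - u) :
    v ^ (-(1:ℝ)/3) * (1 - v) ^ (-(1:ℝ)/3) * (1 - u - v) ^ (-(2:ℝ)/3) =
        (v * (1 - v) / (1 - u - v)) ^ ((1:ℝ)/3) *
          (v ^ (-(2:ℝ)/3) * (1 - v) ^ (-(2:ℝ)/3) * (1 - u - v) ^ (-(1:ℝ)/3)) ∧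
      v ^ (-(2:ℝ)/3) * (1 - v) ^ (-(2:ℝ)/3) * (1 - u - v) ^ (-(1:ℝ)/3) *
          ((v * (1 - v) / (1 - u - v)) ^ ((1:ℝ)/3)) ^ 2 * (1 - u - v) = 1 := by
  have hN : 0 < 1 - u - v := by linarith
  have h1v : 0 < 1 - v := by linarith
  have hg_pos : 0 < v * (1 - v) / (1 - u - v) := div_pos (mul_pos hv h1v) hN
  have inj := (Odd.strictMono_pow (R := ℝ) (n := 3) (by decide)).injective
  constructor
  · apply inj
    simp only
    rw [mul_pow, mul_pow, mul_pow, mul_pow, mul_pow, ← rpow_mul_natCast hv.le,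
      ← rpow_mul_natCast h1v.le, ← rpow_mul_natCast hN.le, ← rpow_mul_natCast hg_pos.le,
      ← rpow_mul_natCast hv.le, ← rpow_mul_natCast h1v.le, ← rpow_mul_natCast hN.le]
    norm_num
    simp only [Real.rpow_neg_one]
    field_simp
  · apply inj
    simp only
    rw [one_pow, mul_pow, mul_pow, mul_pow, mul_pow, ← rpow_mul_natCast hv.le,
      ← rpow_mul_natCast h1v.le, ← rpow_mul_natCast hN.le, ← pow_mul,
      ← rpow_mul_natCast hg_pos.le]
    norm_num
    simp only [Real.rpow_neg_one]
    field_simp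

/-- **THE BOLZA LEVER IS EXACT (assembled).** For `0 < u`, `0 < v < 1 − u` the chart
`a(u,v) = −(z−1)²/z`, `z = (v(1−v)/(1−u−v))^{1/3}`, is differentiable in `v` with derivative `D`
satisfying `D² = Q(a(u,v),u)·((ψ+ψ̄)(u,v)/3)²` EXACTLY, i.e. `|∂a/∂v|/√Q = (ψ+ψ̄)/3` wherever
`Q > 0` (which holds on the image `a < 0`): the rule-(2) integrand relation of the card's step (ii),
`[cell, u^{s−1}(ψ+ψ̄)/2] ~ [Σ_neg, (3/2)u^{s−1}/√Q]`, with no `u`-dependent constant. [folklore] -/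
theorem bolza_lever {u v : ℝ} (hu : 0 < u) (hv : 0 < v) (huv : v < 1 - u) :
    ∃ D : ℝ,
      HasDerivAt (fun t : ℝ => -((t * (1 - t) / (1 - u - t)) ^ ((1:ℝ)/3) - 1) ^ 2 /
          (t * (1 - t) / (1 - u - t)) ^ ((1:ℝ)/3)) D v ∧
      D ^ 2 =
        ((-((v * (1 - v) / (1 - u - v)) ^ ((1:ℝ)/3) - 1) ^ 2 /
              (v * (1 - v) / (1 - u - v)) ^ ((1:ℝ)/3)) ^ 2 *
            (3 - -((v * (1 - v) / (1 - u - v)) ^ ((1:ℝ)/3) - 1) ^ 2 /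
              (v * (1 - v) / (1 - u - v)) ^ ((1:ℝ)/3)) ^ 2 -
          4 * u * (-((v * (1 - v) / (1 - u - v)) ^ ((1:ℝ)/3) - 1) ^ 2 /
              (v * (1 - v) / (1 - u - v)) ^ ((1:ℝ)/3))) *
        ((v ^ (-(2:ℝ)/3) * (1 - v) ^ (-(2:ℝ)/3) * (1 - u - v) ^ (-(1:ℝ)/3) +
            v ^ (-(1:ℝ)/3) * (1 - v) ^ (-(1:ℝ)/3) * (1 - u - v) ^ (-(2:ℝ)/3)) / 3) ^ 2 := by
  have hN : 0 < 1 - u - v := by linarith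
  have h1v : 0 < 1 - v := by linarith
  have hg_pos : 0 < v * (1 - v) / (1 - u - v) := div_pos (mul_pos hv h1v) hN
  set z := (v * (1 - v) / (1 - u - v)) ^ ((1:ℝ)/3) with hzdef
  have hz0 : 0 < z := rpow_pos_of_pos hg_pos _
  set ψ := v ^ (-(2:ℝ)/3) * (1 - v) ^ (-(2:ℝ)/3) * (1 - u - v) ^ (-(1:ℝ)/3) with hψ
  set ψ' := v ^ (-(1:ℝ)/3) * (1 - v) ^ (-(1:ℝ)/3) * (1 - u - v) ^ (-(2:ℝ)/3) with hψ'
  -- chain rule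
  have hchart := hasDerivAt_bolza_chart hu hv huv
  rw [← hzdef] at hchart
  have ha : HasDerivAt (fun y : ℝ => -(y - 1) ^ 2 / y) (-(z - 1) * (z + 1) / z ^ 2) z := by
    have h1 : HasDerivAt (fun y : ℝ => -(y - 1) ^ 2) (-(↑(2:ℕ) * (z - 1) ^ (2 - 1) * 1)) z :=
      (((hasDerivAt_id' z).sub_const 1).pow 2).neg
    have h2 := h1.div (hasDerivAt_id' z) hz0.ne'
    refine h2.congr_deriv ?_
    have h21 : (2:ℕ) - 1 = 1 := rfl
    simp only [h21, pow_one, mul_one, Nat.cast_ofNat]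
    field_simp
    ring
  have hcomp := ha.comp v hchart
  refine ⟨_, hcomp, ?_⟩
  have hz3 : z ^ 3 * (1 - u - v) = v * (1 - v) := by
    rw [hzdef, ← rpow_natCast, ← rpow_mul hg_pos.le]
    norm_num
    field_simp
  have key := bolza_key_identity_exact u v z hN.ne' hz0.ne' hz3
  obtain ⟨h1, h2⟩ := bolza_psi_identities hu hv huv
  rw [← hzdef, ← hψ, ← hψ'] at h1
  rw [← hzdef, ← hψ] at h2
  rw [key, h1]
  congr 1
  have hψz : ψ = 1 / (z ^ 2 * (1 - u - v)) := by
    rw [eq_div_iff (by positivity)]; linear_combination h2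
  rw [hψz]
  field_simp

/-- **The `ι`-fixed point.** The chart value `z = (v(1−v)/(1−u−v))^{1/3}` equals `1` (i.e. `a = 0`)
iff `(1−v)² = u`, i.e. `v = 1 − √u` on `Σ_box`: the cut point between the card's two injectivity
cells. [folklore] -/
theorem bolza_chart_eq_one_iff {u v : ℝ} (hu : 0 < u) (hv : 0 < v) (huv : v < 1 - u) :
    (v * (1 - v) / (1 - u - v)) ^ ((1:ℝ)/3) = 1 ↔ (1 - v) ^ 2 = u := by
  have hN : 0 < 1 - u - v := by linarith
  have h1v : 0 < 1 - v := by linarith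
  have hg_pos : 0 < v * (1 - v) / (1 - u - v) := div_pos (mul_pos hv h1v) hN
  have key : v * (1 - v) / (1 - u - v) = 1 ↔ (1 - v) ^ 2 = u := by
    rw [div_eq_one_iff_eq hN.ne']
    constructor <;> intro h <;> nlinarith [h]
  rw [← key]
  constructor
  · intro h
    have h3 := congrArg (fun x : ℝ => x ^ (3:ℕ)) h
    simp only [one_pow] at h3
    rwa [← rpow_natCast, ← rpow_mul hg_pos.le, show (1:ℝ)/3 * ((3:ℕ):ℝ) = 1 by norm_num,
      rpow_one] at h3
  · intro h
    rw [h, one_rpow]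

/-- **The chart is non-degenerate off the cut**: for `(1−v)² ≠ u` every `v`-derivative `D` of
`a(u,·)` at `v` is non-zero (`D² = Q·((ψ+ψ̄)/3)²`, `Q(a,u) > 0` because `a < 0` strictly, and
`ψ + ψ̄ > 0`). Hence `a(u,·)` is strictly monotone on each cell `v ≶ 1 − √u` (injectivity of the
card's rule-(2) maps `(u,v) ↦ (u, a(u,v))`), with image `(−∞, 0)` on each. [folklore] -/
theorem bolza_chart_deriv_ne_zero {u v D : ℝ} (hu : 0 < u) (hv : 0 < v) (huv : v < 1 - u)
    (hfix : (1 - v) ^ 2 ≠ u)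
    (hD : HasDerivAt (fun t : ℝ => -((t * (1 - t) / (1 - u - t)) ^ ((1:ℝ)/3) - 1) ^ 2 /
          (t * (1 - t) / (1 - u - t)) ^ ((1:ℝ)/3)) D v) : D ≠ 0 := by
  have hN : 0 < 1 - u - v := by linarith
  have h1v : 0 < 1 - v := by linarith
  have hg_pos : 0 < v * (1 - v) / (1 - u - v) := div_pos (mul_pos hv h1v) hN
  obtain ⟨D₀, hD₀, hsq⟩ := bolza_lever hu hv huv
  have hDD : D = D₀ := hD.unique hD₀
  subst hDD
  set z := (v * (1 - v) / (1 - u - v)) ^ ((1:ℝ)/3) with hz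
  have hz0 : 0 < z := rpow_pos_of_pos hg_pos _
  have hz1 : z ≠ 1 := fun h => hfix ((bolza_chart_eq_one_iff hu hv huv).mp h)
  have ha : -(z - 1) ^ 2 / z < 0 := by
    apply div_neg_of_neg_of_pos _ hz0
    have : 0 < (z - 1) ^ 2 := by
      have : z - 1 ≠ 0 := sub_ne_zero.mpr hz1
      positivity
    linarith
  have hQ : 0 < (-(z - 1) ^ 2 / z) ^ 2 * (3 - -(z - 1) ^ 2 / z) ^ 2 -
      4 * u * (-(z - 1) ^ 2 / z) := by
    have h1 : 0 ≤ (-(z - 1) ^ 2 / z) ^ 2 * (3 - -(z - 1) ^ 2 / z) ^ 2 := by positivity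
    nlinarith [mul_pos hu (neg_pos.mpr ha)]
  have hψ : 0 < (v ^ (-(2:ℝ)/3) * (1 - v) ^ (-(2:ℝ)/3) * (1 - u - v) ^ (-(1:ℝ)/3) +
      v ^ (-(1:ℝ)/3) * (1 - v) ^ (-(1:ℝ)/3) * (1 - u - v) ^ (-(2:ℝ)/3)) / 3 := by positivity
  have hpos : 0 < D ^ 2 := by
    rw [hsq]
    exact mul_pos hQ (pow_pos hψ 2)
  intro hD0
  rw [hD0] at hpos
  norm_num at hpos

/-- **`z_v > 0`**: the cube-root chart `z` is strictly increasing in `v` on `Σ_box` (`0 < u < 1`):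
`(1−v)² − u(1−2v) = (v − (1−u))² + u(1−u) > 0`. [folklore] -/
theorem bolza_chart_zv_pos {u v : ℝ} (hu : 0 < u) (hu1 : u < 1) (hv : 0 < v) (huv : v < 1 - u) :
    0 < ((1 - v) ^ 2 - u * (1 - 2 * v)) /
      (3 * ((v * (1 - v) / (1 - u - v)) ^ ((1:ℝ)/3)) ^ 2 * (1 - u - v) ^ 2) := by
  have hN : 0 < 1 - u - v := by linarith
  have h1v : 0 < 1 - v := by linarith
  have hz : 0 < (v * (1 - v) / (1 - u - v)) ^ ((1:ℝ)/3) :=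
    rpow_pos_of_pos (div_pos (mul_pos hv h1v) hN) _
  apply div_pos
  · nlinarith [sq_nonneg (v - (1 - u)), mul_pos hu (sub_pos.mpr hu1)]
  · positivity

/-- **Which side of the cut**: `z < 1 ↔ u < (1−v)²` (i.e. `v < 1 − √u`). [folklore] -/
theorem bolza_chart_lt_one_iff {u v : ℝ} (hu : 0 < u) (hv : 0 < v) (huv : v < 1 - u) :
    (v * (1 - v) / (1 - u - v)) ^ ((1:ℝ)/3) < 1 ↔ u < (1 - v) ^ 2 := by
  have hN : 0 < 1 - u - v := by linarith
  have h1v : 0 < 1 - v := by linarith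
  have hg : 0 < v * (1 - v) / (1 - u - v) := div_pos (mul_pos hv h1v) hN
  have key : v * (1 - v) / (1 - u - v) < 1 ↔ u < (1 - v) ^ 2 := by
    rw [div_lt_one hN]
    constructor <;> intro h <;> nlinarith [h]
  rw [Real.rpow_lt_one_iff_of_pos hg, key]
  constructor
  · rintro (⟨-, h⟩ | ⟨h, -⟩)
    · norm_num at h
    · exact h
  · intro h
    exact Or.inr ⟨h, by norm_num⟩

/-- **Sign of the chart's derivative**: every `v`-derivative `D` of `a(u,·)` is POSITIVE below the cut
(`u < (1−v)²`, i.e. `v < 1 − √u`, where `a` increases from `−∞` to `0`) and NEGATIVE above it (where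
`a` decreases from `0` to `−∞`): with continuity this is the strict monotonicity, hence injectivity,
of the card's two rule-(2) cells, and both cells have image `(−∞, 0)`. [folklore] -/
theorem bolza_chart_deriv_sign {u v D : ℝ} (hu : 0 < u) (hu1 : u < 1) (hv : 0 < v) (huv : v < 1 - u)
    (hD : HasDerivAt (fun t : ℝ => -((t * (1 - t) / (1 - u - t)) ^ ((1:ℝ)/3) - 1) ^ 2 /
          (t * (1 - t) / (1 - u - t)) ^ ((1:ℝ)/3)) D v) :
    (u < (1 - v) ^ 2 → 0 < D) ∧ ((1 - v) ^ 2 < u → D < 0) := by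
  have hN : 0 < 1 - u - v := by linarith
  have h1v : 0 < 1 - v := by linarith
  have hg : 0 < v * (1 - v) / (1 - u - v) := div_pos (mul_pos hv h1v) hN
  set z := (v * (1 - v) / (1 - u - v)) ^ ((1:ℝ)/3) with hz
  have hz0 : 0 < z := rpow_pos_of_pos hg _
  -- the derivative is a_z * z_v (chain rule, uniqueness)
  have hchart := hasDerivAt_bolza_chart hu hv huv
  rw [← hz] at hchart
  have ha : HasDerivAt (fun y : ℝ => -(y - 1) ^ 2 / y) (-(z - 1) * (z + 1) / z ^ 2) z := by
    have h1 : HasDerivAt (fun y : ℝ => -(y - 1) ^ 2) (-(↑(2:ℕ) * (z - 1) ^ (2 - 1) * 1)) z :=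
      (((hasDerivAt_id' z).sub_const 1).pow 2).neg
    have h2 := h1.div (hasDerivAt_id' z) hz0.ne'
    refine h2.congr_deriv ?_
    have h21 : (2:ℕ) - 1 = 1 := rfl
    simp only [h21, pow_one, mul_one, Nat.cast_ofNat]
    field_simp
    ring
  have hcomp := ha.comp v hchart
  have hDD : D = -(z - 1) * (z + 1) / z ^ 2 *
      (((1 - v) ^ 2 - u * (1 - 2 * v)) / (3 * z ^ 2 * (1 - u - v) ^ 2)) :=
    hD.unique hcomp
  have hzv : 0 < ((1 - v) ^ 2 - u * (1 - 2 * v)) / (3 * z ^ 2 * (1 - u - v) ^ 2) := by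
    have := bolza_chart_zv_pos hu hu1 hv huv; rwa [← hz] at this
  have hiff := bolza_chart_lt_one_iff hu hv huv
  rw [← hz] at hiff
  constructor
  · intro h
    have hz1 : z < 1 := hiff.mpr h
    rw [hDD]
    apply mul_pos _ hzv
    apply div_pos _ (by positivity)
    nlinarith
  · intro h
    have hz1 : 1 < z := by
      rcases lt_trichotomy z 1 with hlt | heq | hgt
      · exact absurd (hiff.mp hlt) (by linarith)
      · have : (1 - v) ^ 2 = u := (bolza_chart_eq_one_iff hu hv huv).mp heq
        linarith
      · exact hgt
    rw [hDD]
    apply mul_neg_of_neg_of_pos _ hzv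
    apply div_neg_of_neg_of_pos _ (by positivity)
    nlinarith

end Summit.KontsevichZagierPeriods.TerasomaMultiplication.MultiplicationThreeNegative
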